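import Summits.QuantumFields.BalabanUV.Beta.GAN24.WoodburyFibreZeroModeOsc
import Summits.QuantumFields.BalabanUV.Beta.DecimationRate

/-!
# GAN24 / WoodburyFibreZeroModeDec — DECIMATION TRANSPORTS SMOOTHNESS: a forward-difference bound `ε` at rate `δ` on the fine lattice
# becomes, for the block-contour decimation `dec M K` (an2's `OneStepKernelFamily.dec`), a forward-difference bound `M·ε·e^{δM(4d+5)}` at the
# SHARPENED rate `δ·M` on the `M`-times coarser lattice — the `θ^{n−m}` bookkeeping that feeds `WoodburyFibreZeroModeGainEnd` from a
# fine-level gradient gain (census row V14 of `HOME/b2b-balaban-gan24-p3/WOODBURY-FIBRE.md` v8; binder row G-an2-4 ∕ (CONV-C), P3, gen 8)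

Cell `pub-balaban`, β sub-cell.  HONEST FRAMING (verbatim): discharging `BetaPertH` makes Bałaban's UV stability UNCONDITIONAL — a real
constructive-QFT result; it is NOT the continuum limit and NOT the Clay problem.  HONEST DEPENDENCY (verbatim): continuum YM on T⁴ ⇐
BetaPertH ∧ nine spine estimates (0/9 proved); BetaPertH ⇐ (D1) ∧ (D4) ∧ CAP+tail; G-an2-4 gates asym, D1 and NE2/3/4.  NOT IN PRINT; OUR
BOOKKEEPING.  [folklore] over an2's `dec` ∕ `legPt_add` ∕ `sum_legW`, asym1's `DecimationRate.decays_dec_rate` (rate sharpening `δ ↦ δ·M`) and the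
one-axis walk `WoodburyFibreZeroModeOsc.abs_sub_axis` BY NAME; cites nothing, mints no `def … : Prop`, instantiates no wall binder; every
forward-difference datum is a HYPOTHESIS.  Discharges NOTHING of (CONV-C), the W-slot, «T2Shape», (D1); NEVER «G-an2-4 closed»; NOT BetaPertH, NOT
continuum, NOT Clay.

## Why (context only; asserted nowhere below)
The engine `WoodburyFibreZeroModeGainEnd.decays_comp_ffKInvStep_of_fwdDiff` wants, on the leg adjacent to `Γ_m^{ff}`, a forward-difference
bound on the STEP-`m` LATTICE.  A «soft composite leg from level `n`» is a fine-lattice object with a gradient gain (the `(L^jη)^{−1}` of [B9]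
(3.49); gen 7's `posDecay_dMinimiser` ∕ `one_sub_projR_deriv_decay` for the scalar box objects) read through the decimation `dec (Lc^m)`.  This
file is the transport: one step on the coarse lattice moves every leg point by `M` fine steps (`legPt_add`), so the coarse forward difference of
`dec M K` IS `dec M` of the `M`-step fine difference of `K` (`dec_fwdDiff_row ∕ _col`), which the one-axis walk bounds by `M·ε·e^{δM}` at the fine
rate; `decays_dec_rate` then sharpens the rate to `δ·M` on the coarse lattice.  READING: `ε = c·Lc^{−n}`, `δ = δ₀·Lc^{−n}` (a level-`n` leg in
fine units), `M = Lc^m` ⇒ coarse bound `c·Lc^{−(n−m)}·e^{δ₀(4d+5)Lc^{−(n−m)}}` at rate `δ₀·Lc^{−(n−m)}` — the factor `θ^{n−m} = Lc^{−(n−m)}`, with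
`m`-, `n`-free constants.

## Contents (all [folklore]; `D = d+1`, fibre `Fib d`)
* `axisDiffRow M μ K` ∕ `axisDiffCol M μ K` (the `M`-step fine differences in the first ∕ second variable), **`dec_fwdDiff_row`** ∕ **`dec_fwdDiff_col`**
  (coarse forward difference of `dec M K` = `dec M` of the `M`-step fine difference);
* **`decays_axisDiffRow`** ∕ **`decays_axisDiffCol`**: fine bound `|K(p + e_μ, q) − K(p, q)| ≤ ε·e^{−δ|p−q|₁}` ⇒ `Decays (axisDiffRow M μ K) (M·ε·e^{δM}) δ`;
* **`fwdDiff_dec_row`** ∕ **`fwdDiff_dec_col`**: ⇒ `|dec M K (x′ + e_μ) y′ a b − dec M K x′ y′ a b| ≤ (M·ε·e^{δM}·e^{4δ(d+1)M})·e^{−(δ·M)|x′ − y′|₁}` — LITERALLY the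
  hypothesis shape `hD` of `WoodburyFibreZeroModeOsc.decays_sub_contourRef(L)` ∕ `…GainEnd` on the coarse lattice, with `ε′ = M·ε·e^{δM(4d+5)}` and rate `δ·M`.
-/

noncomputable section

open Finset
open scoped BigOperators
open Literature.MathematicalPhysics.QuantumFieldTheory
open Literature.MathematicalPhysics.QuantumFieldTheory.Balaban1983to89
open Literature.MathematicalPhysics.QuantumFieldTheory.Balaban1983to89.Beta
open B12Sec2to5 (l1 l1_nonneg)
open ExpKernelCalculus (MKer Decays)
open AffineAveraging (unitVec)
open OneStepResolventKernel (Fib)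
open OneStepKernelFamily (legSet legPt legW dec legW_nonneg sum_legW legPt_add)
open Summit.QuantumFields.BalabanUV.Beta.DecimationRate (decays_dec_rate)
open Summit.QuantumFields.BalabanUV.Beta.GAN24.WoodburyFibreZeroModeOsc (abs_sub_axis l1_natCast_smul_unitVec exp_weight_shift)

namespace Summit.QuantumFields.BalabanUV.Beta.GAN24.WoodburyFibreZeroModeDec

variable {d : ℕ}

/-! ## §1 The coarse forward difference of a decimated kernel is the decimation of an `M`-step fine difference -/

/-- The `M`-step fine difference of `K` in its FIRST variable along the axis `μ`. [folklore] -/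
def axisDiffRow (M : ℕ) (μ : Fin (d + 1)) (K : MKer (d + 1) (Fib d)) : MKer (d + 1) (Fib d) :=
  fun p q a b => K (p + (M : ℤ) • unitVec μ) q a b - K p q a b

/-- The `M`-step fine difference of `K` in its SECOND variable along the axis `μ`. [folklore] -/
def axisDiffCol (M : ℕ) (μ : Fin (d + 1)) (K : MKer (d + 1) (Fib d)) : MKer (d + 1) (Fib d) :=
  fun p q a b => K p (q + (M : ℤ) • unitVec μ) a b - K p q a b

/-- **COARSE FORWARD DIFFERENCE = DECIMATED `M`-STEP FINE DIFFERENCE** (first variable): one coarse step moves every leg point by `M•e_μ`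
(`legPt_add`). [folklore] -/
theorem dec_fwdDiff_row (M : ℕ) (K : MKer (d + 1) (Fib d)) (μ : Fin (d + 1)) (x' y' : Fin (d + 1) → ℤ) (a b : Fib d) :
    dec M K (x' + unitVec μ) y' a b - dec M K x' y' a b = dec M (axisDiffRow M μ K) x' y' a b := by
  simp only [dec, axisDiffRow, legPt_add, mul_sub, Finset.sum_sub_distrib]

/-- **COARSE FORWARD DIFFERENCE = DECIMATED `M`-STEP FINE DIFFERENCE** (second variable). [folklore] -/
theorem dec_fwdDiff_col (M : ℕ) (K : MKer (d + 1) (Fib d)) (μ : Fin (d + 1)) (x' y' : Fin (d + 1) → ℤ) (a b : Fib d) :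
    dec M K x' (y' + unitVec μ) a b - dec M K x' y' a b = dec M (axisDiffCol M μ K) x' y' a b := by
  simp only [dec, axisDiffCol, legPt_add, mul_sub, Finset.sum_sub_distrib]

/-! ## §2 The `M`-step fine difference inherits the fine forward-difference bound times `M·e^{δM}` -/

/-- **ROW VERSION**: `|K(p + e_μ, q) − K(p, q)| ≤ ε·e^{−δ|p−q|₁}` for all `μ, p, q` ⇒ `Decays (axisDiffRow M μ K) (M·ε·e^{δM}) δ` (one-axis walk). [folklore] -/
theorem decays_axisDiffRow {K : MKer (d + 1) (Fib d)} {ε δ : ℝ} (hε : 0 ≤ ε) (hδ : 0 ≤ δ)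
    (hD : ∀ μ p q a b, |K (p + unitVec μ) q a b - K p q a b| ≤ ε * Real.exp (-δ * l1 (p - q))) (M : ℕ) (μ : Fin (d + 1)) :
    Decays (axisDiffRow M μ K) ((M : ℝ) * ε * Real.exp (δ * M)) δ := by
  intro p q a b
  exact abs_sub_axis (g := fun w => K w q a b) (z := q) hε hδ (fun ν w => hD ν w q a b) μ p M

/-- **COLUMN VERSION**: `|K(p, q + e_μ) − K(p, q)| ≤ ε·e^{−δ|p−q|₁}` for all `μ, p, q` ⇒ `Decays (axisDiffCol M μ K) (M·ε·e^{δM}) δ`. [folklore] -/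
theorem decays_axisDiffCol {K : MKer (d + 1) (Fib d)} {ε δ : ℝ} (hε : 0 ≤ ε) (hδ : 0 ≤ δ)
    (hD : ∀ μ p q a b, |K p (q + unitVec μ) a b - K p q a b| ≤ ε * Real.exp (-δ * l1 (p - q))) (M : ℕ) (μ : Fin (d + 1)) :
    Decays (axisDiffCol M μ K) ((M : ℝ) * ε * Real.exp (δ * M)) δ := by
  intro p q a b
  have h := abs_sub_axis (g := fun w => K p w a b) (z := p) hε hδ
    (fun ν w => by rw [ExpKernelCalculus.l1_sub_symm]; exact hD ν p w a b) μ q M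
  rw [ExpKernelCalculus.l1_sub_symm] at h
  exact h

/-! ## §3 The transport: coarse forward-difference bounds for `dec M K` at the sharpened rate `δ·M` -/

/-- **DECIMATION TRANSPORTS SMOOTHNESS (first variable)**: a fine forward-difference bound `(ε, δ)` on the first variable of `K` gives, for
`M ≥ 1`, `|dec M K (x′ + e_μ) y′ a b − dec M K x′ y′ a b| ≤ (M·ε·e^{δM}·e^{4δ(d+1)M})·e^{−(δ·M)|x′ − y′|₁}` — the hypothesis shape of
`WoodburyFibreZeroModeOsc.decays_sub_contourRef` on the coarse lattice with `ε′ = M·ε·e^{δM(4d+5)}` at rate `δ·M`. [folklore] -/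
theorem fwdDiff_dec_row {K : MKer (d + 1) (Fib d)} {ε δ : ℝ} (hε : 0 ≤ ε) (hδ : 0 ≤ δ)
    (hD : ∀ μ p q a b, |K (p + unitVec μ) q a b - K p q a b| ≤ ε * Real.exp (-δ * l1 (p - q))) {M : ℕ} (hM : 1 ≤ M)
    (μ : Fin (d + 1)) (x' y' : Fin (d + 1) → ℤ) (a b : Fib d) :
    |dec M K (x' + unitVec μ) y' a b - dec M K x' y' a b|
      ≤ ((M : ℝ) * ε * Real.exp (δ * M)) * Real.exp (δ * (4 * (d + 1) * M)) * Real.exp (-(δ * M) * l1 (x' - y')) := by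
  rw [dec_fwdDiff_row]
  exact decays_dec_rate (decays_axisDiffRow hε hδ hD M μ) (by positivity) hδ hM x' y' a b

/-- **DECIMATION TRANSPORTS SMOOTHNESS (second variable)** — the hypothesis shape of `decays_sub_contourRefL` on the coarse lattice. [folklore] -/
theorem fwdDiff_dec_col {K : MKer (d + 1) (Fib d)} {ε δ : ℝ} (hε : 0 ≤ ε) (hδ : 0 ≤ δ)
    (hD : ∀ μ p q a b, |K p (q + unitVec μ) a b - K p q a b| ≤ ε * Real.exp (-δ * l1 (p - q))) {M : ℕ} (hM : 1 ≤ M)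
    (μ : Fin (d + 1)) (x' y' : Fin (d + 1) → ℤ) (a b : Fib d) :
    |dec M K x' (y' + unitVec μ) a b - dec M K x' y' a b|
      ≤ ((M : ℝ) * ε * Real.exp (δ * M)) * Real.exp (δ * (4 * (d + 1) * M)) * Real.exp (-(δ * M) * l1 (x' - y')) := by
  rw [dec_fwdDiff_col]
  exact decays_dec_rate (decays_axisDiffCol hε hδ hD M μ) (by positivity) hδ hM x' y' a b

/-- The same, first variable, with the two exponential prefactors merged: `ε′ = M·ε·e^{δM(4d+5)}`. [folklore] -/
theorem fwdDiff_dec_row' {K : MKer (d + 1) (Fib d)} {ε δ : ℝ} (hε : 0 ≤ ε) (hδ : 0 ≤ δ)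
    (hD : ∀ μ p q a b, |K (p + unitVec μ) q a b - K p q a b| ≤ ε * Real.exp (-δ * l1 (p - q))) {M : ℕ} (hM : 1 ≤ M)
    (μ : Fin (d + 1)) (x' y' : Fin (d + 1) → ℤ) (a b : Fib d) :
    |dec M K (x' + unitVec μ) y' a b - dec M K x' y' a b|
      ≤ ((M : ℝ) * ε * Real.exp (δ * ((M : ℝ) * (4 * d + 5)))) * Real.exp (-(δ * M) * l1 (x' - y')) := by
  refine (fwdDiff_dec_row hε hδ hD hM μ x' y' a b).trans (le_of_eq ?_)
  rw [show δ * ((M : ℝ) * (4 * d + 5)) = δ * M + δ * (4 * (d + 1) * M) by ring, Real.exp_add]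
  ring

/-- The same, second variable, merged prefactors. [folklore] -/
theorem fwdDiff_dec_col' {K : MKer (d + 1) (Fib d)} {ε δ : ℝ} (hε : 0 ≤ ε) (hδ : 0 ≤ δ)
    (hD : ∀ μ p q a b, |K p (q + unitVec μ) a b - K p q a b| ≤ ε * Real.exp (-δ * l1 (p - q))) {M : ℕ} (hM : 1 ≤ M)
    (μ : Fin (d + 1)) (x' y' : Fin (d + 1) → ℤ) (a b : Fib d) :
    |dec M K x' (y' + unitVec μ) a b - dec M K x' y' a b|
      ≤ ((M : ℝ) * ε * Real.exp (δ * ((M : ℝ) * (4 * d + 5)))) * Real.exp (-(δ * M) * l1 (x' - y')) := by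
  refine (fwdDiff_dec_col hε hδ hD hM μ x' y' a b).trans (le_of_eq ?_)
  rw [show δ * ((M : ℝ) * (4 * d + 5)) = δ * M + δ * (4 * (d + 1) * M) by ring, Real.exp_add]
  ring

end Summit.QuantumFields.BalabanUV.Beta.GAN24.WoodburyFibreZeroModeDec

end
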